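import Literature.Analysis.FluidPDE.HeatRieszKernel
import Literature.Analysis.FluidPDE.HessianLaplacianLpProofs
import Literature.Analysis.SingularIntegrals.HormanderGradient
import HarnessLib

/-!
# Stein's `L^p` bound for the Hessian by the Laplacian in every dimension: discharge

Analysis/FluidPDE proof file; sibling of `HessianLaplacianLp` (the named fact
`Literature.Analysis.FluidPDE.stein1970_hessian_Lp_bound E`: E. M. Stein, *Singular integrals*
(1970), Ch. III §1.3 **Proposition 3**, p. 59 — for `f ∈ C²` with compact support,
`‖∂ⱼ∂ₖ f‖_p ≤ A_p ‖Δf‖_p`, `1 < p < ∞`) and of `HessianLaplacianLpProofs` (the discharge on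
`ℝ³` through the Newtonian kernel). This file PROVES the fact for **every** finite-dimensional real
inner product space,

* `stein1970_hessian_Lp_bound_holds : stein1970_hessian_Lp_bound E`,

by the Calderón–Zygmund `L^p` theory of the tree (`Literature/Analysis/SingularIntegrals/`, Stein
1970 Ch. I §3–4, Ch. II §2–3: `SingularIntegrals.exists_eLpNorm_le`) applied to the **Riesz
kernels of the heat semigroup** (Stein 1970, Ch. III §1.3 `∂ⱼ∂ₖf = -RⱼRₖΔf` with
`-Δ⁻¹ = ∫₀^∞ e^{sΔ} ds`, Ch. III §2): for `ε = e^{-m}`, `R = e^{m}` and a truncation radius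
`M = M_m → ∞` let `P = ∫_ε^R G_s ds` (`FluidPDE/HeatRieszKernel`), `Φ = χ_M P` (`χ_M = cutoff M`)
and `K = ∂ₐ∂ₐΦ ∈ C^∞_c` (`rieszHeatKernel`). Then, uniformly in `m` and `|a| ≤ 2`:

* `‖K * h‖₂ ≤ 12 ‖h‖₂` (`eLpNorm_conv_rieszHeatKernel_le`): `K * h = ∂ₐ∂ₐ(Φ * h)` with
  `Φ * h ∈ C^∞_c`, so `‖∂ₐ∂ₐ(Φ*h)‖₂ ≤ |a|²‖Δ(Φ*h)‖₂` (two integrations by parts,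
  `integral_sq_fderiv_fderiv_apply_le`) and `Δ(Φ * h) = (ΔΦ) * h` with
  `‖ΔΦ‖₁ ≤ ‖G_R - G_ε‖₁ + (truncation terms) ≤ 3` (`ΔP = G_R - G_ε`, `laplacian_heatPot`);
* Hörmander's condition (`lintegral_hormander_rieszHeatKernel_le`): `K = χ_M ∂ₐ∂ₐP + K₂` with
  `|∇(χ_M ∂ₐ∂ₐP)| ≤ C|x|^{-n-1}` (`HeatRieszKernel.norm_fderiv_heatPotD2_le`, `abs_heatPotD2_le`)
  and `‖K₂‖₁ ≤ 1`, whence the bound by `SingularIntegrals.lintegral_hormander_le_of_norm_fderiv_le_add`;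
* the representation `(K * Δf)(x) = e^{RΔ}(∂ₐ∂ₐf)(x) - e^{εΔ}(∂ₐ∂ₐf)(x)` once `M > |x| + ρ_f`
  (`integral_laplacian_mul_rieszHeatKernel`: Green's identity, `Δ∂ₐ∂ₐ = ∂ₐ∂ₐΔ`, two integrations
  by parts, `ΔΦ = G_R - G_ε` near the relevant points), which tends to `-∂ₐ∂ₐf(x)`
  (`e^{RΔ}φ → 0`, `e^{εΔ}φ → φ`);

so that Fatou gives `‖∂ₐ∂ₐf‖_p ≤ C_p‖Δf‖_p` for `|a| ≤ 2` (`exists_eLpNorm_fderiv_fderiv_le_general`)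
and polarisation gives the mixed derivatives (as in the `ℝ³` file). Dimension `0` is trivial.

## References

* E. M. Stein, *Singular integrals and differentiability properties of functions*, Princeton
  Math. Series 30 (1970): Ch. III §1.3 Proposition 3 (p. 59), §1.2–1.3 (Riesz transforms),
  §2 (heat semigroup); Ch. II §3.2 Theorem 2, §4.2 Theorem 3. [`Stein1971`]
* L. C. Evans, *Partial Differential Equations*, 2nd ed. (2010), §2.3.1. [`Evans2010`]
-/

noncomputable section

open MeasureTheory Set Filter Topology Function Metric InnerProductSpace
open scoped ENNReal NNReal RealInnerProductSpace ContDiff Laplacian Convolution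

namespace Literature.Analysis.FluidPDE

open UnboundedOperators (heatKernel heatExtension)

universe u

variable {E : Type u} [NormedAddCommGroup E] [InnerProductSpace ℝ E] [FiniteDimensional ℝ E]
  [MeasurableSpace E] [BorelSpace E]

namespace RieszHeat

/-! ### Pointwise calculus -/

omit [FiniteDimensional ℝ E] [MeasurableSpace E] [BorelSpace E] in
/-- **Second directional derivative of a product**:
`∂ₐ∂ₐ(fg) = f ∂ₐ∂ₐg + 2 ∂ₐf ∂ₐg + g ∂ₐ∂ₐf` for `C²` functions. [folklore] -/
theorem fderiv_fderiv_mul_apply {f g : E → ℝ} (hf : ContDiff ℝ 2 f) (hg : ContDiff ℝ 2 g)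
    (z a : E) :
    fderiv ℝ (fun w => fderiv ℝ (fun y => f y * g y) w a) z a =
      f z * fderiv ℝ (fun w => fderiv ℝ g w a) z a + 2 * (fderiv ℝ f z a * fderiv ℝ g z a) +
        g z * fderiv ℝ (fun w => fderiv ℝ f w a) z a := by
  have hf1 : ContDiff ℝ 1 f := hf.of_le one_le_two
  have hg1 : ContDiff ℝ 1 g := hg.of_le one_le_two
  have hfd : ∀ y, DifferentiableAt ℝ f y := fun y => hf1.differentiable one_ne_zero y
  have hgd : ∀ y, DifferentiableAt ℝ g y := fun y => hg1.differentiable one_ne_zero y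
  have hfa : ContDiff ℝ 1 fun y => fderiv ℝ f y a :=
    (hf.fderiv_right (m := 1) le_rfl).clm_apply contDiff_const
  have hga : ContDiff ℝ 1 fun y => fderiv ℝ g y a :=
    (hg.fderiv_right (m := 1) le_rfl).clm_apply contDiff_const
  have h1 : (fun y => fderiv ℝ (fun y => f y * g y) y a) =
      fun y => fderiv ℝ f y a * g y + f y * fderiv ℝ g y a := by
    funext y
    rw [fderiv_fun_mul (hfd y) (hgd y)]
    simp only [_root_.add_apply, FunLike.coe_smul, Pi.smul_apply, smul_eq_mul]
    ring
  rw [h1]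
  have hA : DifferentiableAt ℝ (fun y => fderiv ℝ f y a * g y) z :=
    (hfa.differentiable one_ne_zero z).mul (hgd z)
  have hB : DifferentiableAt ℝ (fun y => f y * fderiv ℝ g y a) z :=
    (hfd z).mul (hga.differentiable one_ne_zero z)
  rw [fderiv_fun_add hA hB, fderiv_fun_mul (hfa.differentiable one_ne_zero z) (hgd z),
    fderiv_fun_mul (hfd z) (hga.differentiable one_ne_zero z)]
  simp only [_root_.add_apply, FunLike.coe_smul, Pi.smul_apply, smul_eq_mul]
  ring

omit [MeasurableSpace E] [BorelSpace E] in
/-- `|Δχ| ≤ n ‖D²χ‖` (trace against operator norm, `n = dim E`). [folklore] -/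
theorem abs_laplacian_le_finrank_mul_norm {χ : E → ℝ} (hχ : ContDiff ℝ 2 χ) (z : E) :
    |Δ χ z| ≤ Module.finrank ℝ E * ‖fderiv ℝ (fderiv ℝ χ) z‖ := by
  set b := stdOrthonormalBasis ℝ E
  have hD : Differentiable ℝ (fderiv ℝ χ) :=
    (hχ.fderiv_right (m := 1) le_rfl).differentiable one_ne_zero
  rw [laplacian_eq_sum_fderiv_fderiv b hχ z]
  have hterm : ∀ i, |fderiv ℝ (fun y => fderiv ℝ χ y (b i)) z (b i)| ≤ ‖fderiv ℝ (fderiv ℝ χ) z‖ := by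
    intro i
    rw [fderiv_apply_const_apply (hD z), ← Real.norm_eq_abs]
    calc ‖fderiv ℝ (fderiv ℝ χ) z (b i) (b i)‖ ≤ ‖fderiv ℝ (fderiv ℝ χ) z‖ * ‖b i‖ * ‖b i‖ :=
          (fderiv ℝ (fderiv ℝ χ) z).le_opNorm₂ _ _
      _ = ‖fderiv ℝ (fderiv ℝ χ) z‖ := by rw [b.orthonormal.1, mul_one, mul_one]
  calc |∑ i, fderiv ℝ (fun y => fderiv ℝ χ y (b i)) z (b i)|
      ≤ ∑ i, |fderiv ℝ (fun y => fderiv ℝ χ y (b i)) z (b i)| := Finset.abs_sum_le_sum_abs _ _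
    _ ≤ ∑ _i : Fin (Module.finrank ℝ E), ‖fderiv ℝ (fderiv ℝ χ) z‖ := Finset.sum_le_sum fun i _ => hterm i
    _ = Module.finrank ℝ E * ‖fderiv ℝ (fderiv ℝ χ) z‖ := by
        rw [Finset.sum_const, Finset.card_univ, Fintype.card_fin, nsmul_eq_mul]

omit [FiniteDimensional ℝ E] [MeasurableSpace E] [BorelSpace E] in
/-- `|∂ₐ∂ₐχ(z)| ≤ ‖D²χ(z)‖ ‖a‖²`. [folklore] -/
theorem abs_fderiv_fderiv_apply_le {χ : E → ℝ} (hχ : ContDiff ℝ 2 χ) (z a : E) :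
    |fderiv ℝ (fun y => fderiv ℝ χ y a) z a| ≤ ‖fderiv ℝ (fderiv ℝ χ) z‖ * ‖a‖ ^ 2 := by
  have hD : Differentiable ℝ (fderiv ℝ χ) :=
    (hχ.fderiv_right (m := 1) le_rfl).differentiable one_ne_zero
  rw [fderiv_apply_const_apply (hD z), ← Real.norm_eq_abs, sq, ← mul_assoc]
  exact (fderiv ℝ (fderiv ℝ χ) z).le_opNorm₂ _ _

omit [FiniteDimensional ℝ E] [MeasurableSpace E] [BorelSpace E] in
/-- If `f` vanishes near `z` then so does `∂ₐ∂ₐf(z)`; hence `∂ₐ∂ₐf ≠ 0` only on `tsupport f`. [folklore] -/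
theorem fderiv_fderiv_apply_eq_zero_of_notMem_tsupport {f : E → ℝ} {z : E} (hz : z ∉ tsupport f)
    (a : E) : fderiv ℝ (fun y => fderiv ℝ f y a) z a = 0 := by
  have h0 : f =ᶠ[𝓝 z] fun _ => 0 := notMem_tsupport_iff_eventuallyEq.1 hz
  have h1 : (fun y => fderiv ℝ f y a) =ᶠ[𝓝 z] fun _ => 0 := by
    filter_upwards [h0.eventually_nhds] with y hy
    rw [Filter.EventuallyEq.fderiv_eq (hy : f =ᶠ[𝓝 y] fun _ => (0 : ℝ))]
    simp
  rw [h1.fderiv_eq]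
  simp

/-! ### Convolution calculus with a smooth compactly supported kernel (general dimension) -/

section Conv

variable {h g : E → ℝ}

/-- The convolution with the scalar pairing, as an explicit integral. [folklore] -/
theorem conv_lsmul_apply (h g : E → ℝ) (x : E) :
    (h ⋆[ContinuousLinearMap.lsmul ℝ ℝ, volume] g) x = ∫ t, h t * g (x - t) := by
  rw [convolution_lsmul]
  rfl

/-- `∂ₐ(h * g) = h * ∂ₐg` for `g ∈ C¹_c`, `h ∈ L¹_loc`. [folklore] -/
theorem fderiv_conv_apply (hh : LocallyIntegrable h) (hg : ContDiff ℝ 1 g)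
    (hgc : HasCompactSupport g) (x a : E) :
    fderiv ℝ (h ⋆[ContinuousLinearMap.lsmul ℝ ℝ, volume] g) x a =
      (h ⋆[ContinuousLinearMap.lsmul ℝ ℝ, volume] fun s => fderiv ℝ g s a) x := by
  rw [(hgc.hasFDerivAt_convolution_right (ContinuousLinearMap.lsmul ℝ ℝ) hh hg x).fderiv,
    convolution_precompR_apply (ContinuousLinearMap.lsmul ℝ ℝ) hh (hgc.fderiv ℝ)
      (hg.continuous_fderiv one_ne_zero)]

/-- **Second directional derivatives:** `∂ₐ∂ₐ(h * g)(x) = ∫ h(t) ∂ₐ∂ₐg(x - t) dt`. [folklore] -/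
theorem fderiv_fderiv_conv_apply (hh : Continuous h) (hg : ContDiff ℝ ∞ g)
    (hgc : HasCompactSupport g) (x a : E) :
    fderiv ℝ (fun y => fderiv ℝ (h ⋆[ContinuousLinearMap.lsmul ℝ ℝ, volume] g) y a) x a =
      ∫ t, h t * fderiv ℝ (fun s => fderiv ℝ g s a) (x - t) a := by
  have hg1 : ContDiff ℝ 1 g := hg.of_le (by exact_mod_cast le_top)
  have hga : ContDiff ℝ ∞ fun s => fderiv ℝ g s a :=
    (hg.fderiv_right (m := ∞) (by exact_mod_cast le_top)).clm_apply contDiff_const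
  have hga1 : ContDiff ℝ 1 fun s => fderiv ℝ g s a := hga.of_le (by exact_mod_cast le_top)
  have hgac : HasCompactSupport fun s => fderiv ℝ g s a := hgc.fderiv_apply ℝ a
  have hfun : (fun y => fderiv ℝ (h ⋆[ContinuousLinearMap.lsmul ℝ ℝ, volume] g) y a) =
      (h ⋆[ContinuousLinearMap.lsmul ℝ ℝ, volume] fun s => fderiv ℝ g s a) :=
    funext fun y => fderiv_conv_apply hh.locallyIntegrable hg1 hgc y a
  rw [hfun, fderiv_conv_apply hh.locallyIntegrable hga1 hgac x a, conv_lsmul_apply]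

/-- **The Laplacian of a convolution:** `Δ(h * g)(x) = ∫ h(t) Δg(x - t) dt`. [folklore] -/
theorem laplacian_conv (hh : Continuous h) (hhc : HasCompactSupport h) (hg : ContDiff ℝ ∞ g)
    (hgc : HasCompactSupport g) (x : E) :
    Δ (h ⋆[ContinuousLinearMap.lsmul ℝ ℝ, volume] g) x = ∫ t, h t * (Δ g) (x - t) := by
  set b := stdOrthonormalBasis ℝ E
  have h2 : ContDiff ℝ 2 (h ⋆[ContinuousLinearMap.lsmul ℝ ℝ, volume] g) :=
    (hgc.contDiff_convolution_right _ hh.locallyIntegrable hg).of_le (by decide)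
  rw [laplacian_eq_sum_fderiv_fderiv b h2 x]
  simp_rw [fderiv_fderiv_conv_apply hh hg hgc x]
  have hg2 : ContDiff ℝ 2 g := hg.of_le (by decide)
  have hint : ∀ i, Integrable fun t => h t * fderiv ℝ (fun s => fderiv ℝ g s (b i)) (x - t) (b i) := by
    intro i
    refine (hh.mul ?_).integrable_of_hasCompactSupport hhc.mul_right
    exact (continuous_fderiv_fderiv_apply hg2 _ _).comp (continuous_const.sub continuous_id)
  rw [← integral_finsetSum _ fun i _ => hint i]
  refine integral_congr_ae (Eventually.of_forall fun t => ?_)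
  simp only
  rw [laplacian_eq_sum_fderiv_fderiv b hg2 (x - t), Finset.mul_sum]

/-- The two orders of the scalar convolution integral agree:
`∫ h(t) k(x - t) dt = ∫ k(t) h(x - t) dt`. [folklore] -/
theorem integral_mul_comp_sub_comm (h k : E → ℝ) (x : E) :
    ∫ t, h t * k (x - t) = ∫ t, k t * h (x - t) := by
  have e := (integral_sub_left_eq_self (fun t => h t * k (x - t)) volume x).symm
  simp only [sub_sub_cancel] at e
  rw [e]
  exact integral_congr_ae (Eventually.of_forall fun t => mul_comm _ _)

/-- Measurability of `x ↦ ∫ h(t) k(x - t) dt` for continuous `h`, `k`. [folklore] -/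
theorem aestronglyMeasurable_integral_mul_comp_sub {k : E → ℝ} (hh : Continuous h) (hk : Continuous k) :
    AEStronglyMeasurable (fun x => ∫ t, h t * k (x - t)) volume := by
  have hm : StronglyMeasurable (uncurry fun x t : E => h t * k (x - t)) :=
    ((hh.comp continuous_snd).mul (hk.comp (continuous_fst.sub continuous_snd))).stronglyMeasurable
  exact hm.integral_prod_right.aestronglyMeasurable

end Conv

/-! ### `L²` comparison from squared integrals -/

/-- `‖f‖_{L²} = ofReal ((∫ f²)^{1/2})` for `f ∈ L²` real-valued. [folklore] -/
theorem eLpNorm_two_eq_ofReal_rpow {f : E → ℝ} (hf : MemLp f 2 volume) :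
    eLpNorm f 2 volume = ENNReal.ofReal ((∫ x, f x ^ 2) ^ (1 / 2 : ℝ)) := by
  rw [hf.eLpNorm_eq_integral_rpow_norm two_ne_zero ENNReal.ofNat_ne_top]
  have h2 : (2 : ℝ≥0∞).toReal = 2 := by norm_num
  simp only [h2, Real.norm_eq_abs, Real.rpow_two, sq_abs, one_div]

/-- From `∫ f² ≤ c² ∫ g²` (`f, g ∈ L²`, `c ≥ 0`) to `‖f‖_{L²} ≤ c ‖g‖_{L²}`. [folklore] -/
theorem eLpNorm_two_le_of_integral_sq_le {f g : E → ℝ} (hf : MemLp f 2 volume)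
    (hg : MemLp g 2 volume) {c : ℝ} (hc : 0 ≤ c) (h : ∫ x, f x ^ 2 ≤ c ^ 2 * ∫ x, g x ^ 2) :
    eLpNorm f 2 volume ≤ ENNReal.ofReal c * eLpNorm g 2 volume := by
  rw [eLpNorm_two_eq_ofReal_rpow hf, eLpNorm_two_eq_ofReal_rpow hg, ← ENNReal.ofReal_mul hc]
  refine ENNReal.ofReal_le_ofReal ?_
  have hg0 : 0 ≤ ∫ x, g x ^ 2 := integral_nonneg fun x => sq_nonneg _
  have hf0 : 0 ≤ ∫ x, f x ^ 2 := integral_nonneg fun x => sq_nonneg _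
  calc (∫ x, f x ^ 2) ^ (1 / 2 : ℝ) ≤ (c ^ 2 * ∫ x, g x ^ 2) ^ (1 / 2 : ℝ) :=
        Real.rpow_le_rpow hf0 h (by norm_num)
    _ = c * (∫ x, g x ^ 2) ^ (1 / 2 : ℝ) := by
        rw [Real.mul_rpow (sq_nonneg c) hg0, ← Real.sqrt_eq_rpow (c ^ 2), Real.sqrt_sq hc]

/-! ### Thresholds for the truncation radius -/

/-- For finite `L₀, L₁` and `a, b ≥ 0` there is `M₀ ≥ 1` with `(a/M²) L₀ + (b/M) L₁ ≤ 1` for all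
`M ≥ M₀`. [folklore] -/
theorem exists_forall_smallness {L₀ L₁ : ℝ≥0∞} (h₀ : L₀ ≠ ⊤) (h₁ : L₁ ≠ ⊤) {a b : ℝ} (ha : 0 ≤ a)
    (hb : 0 ≤ b) :
    ∃ M₀ : ℝ, 1 ≤ M₀ ∧ ∀ M : ℝ, M₀ ≤ M →
      ENNReal.ofReal (a / M ^ 2) * L₀ + ENNReal.ofReal (b / M) * L₁ ≤ 1 := by
  set l₀ := L₀.toReal with hl₀
  set l₁ := L₁.toReal with hl₁
  have e₀ : L₀ = ENNReal.ofReal l₀ := (ENNReal.ofReal_toReal h₀).symm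
  have e₁ : L₁ = ENNReal.ofReal l₁ := (ENNReal.ofReal_toReal h₁).symm
  have hl₀0 : 0 ≤ l₀ := ENNReal.toReal_nonneg
  have hl₁0 : 0 ≤ l₁ := ENNReal.toReal_nonneg
  refine ⟨max 1 (a * l₀ + b * l₁), le_max_left _ _, fun M hM => ?_⟩
  have hM1 : 1 ≤ M := (le_max_left _ _).trans hM
  have hM0 : 0 < M := by linarith
  have hS : a * l₀ + b * l₁ ≤ M := (le_max_right _ _).trans hM
  rw [e₀, e₁, ← ENNReal.ofReal_mul (by positivity), ← ENNReal.ofReal_mul (by positivity),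
    ← ENNReal.ofReal_add (by positivity) (by positivity), ← ENNReal.ofReal_one]
  refine ENNReal.ofReal_le_ofReal ?_
  have h1 : a / M ^ 2 * l₀ ≤ a * l₀ / M := by
    rw [div_mul_eq_mul_div]
    exact div_le_div_of_nonneg_left (by positivity) hM0 (by nlinarith)
  calc a / M ^ 2 * l₀ + b / M * l₁ ≤ a * l₀ / M + b * l₁ / M := by
        rw [div_mul_eq_mul_div b M l₁]; linarith
    _ = (a * l₀ + b * l₁) / M := by ring
    _ ≤ 1 := by rw [div_le_one hM0]; exact hS

/-! ### The cut-off: local constancy -/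

omit [FiniteDimensional ℝ E] [MeasurableSpace E] [BorelSpace E] in
/-- Inside the ball of radius `M` the cut-off is locally `1`. [folklore] -/
theorem cutoff_eventuallyEq_one {M : ℝ} (hM : 0 < M) {z : E} (hz : ‖z‖ < M) :
    (cutoff (E := E) M) =ᶠ[𝓝 z] fun _ => 1 := by
  have hopen : IsOpen {w : E | ‖w‖ < M} := isOpen_lt continuous_norm continuous_const
  filter_upwards [hopen.mem_nhds hz] with w hw
  exact cutoff_eq_one hM (le_of_lt hw)

omit [FiniteDimensional ℝ E] [MeasurableSpace E] [BorelSpace E] in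
/-- Outside the ball of radius `2M` the cut-off is locally `0`. [folklore] -/
theorem cutoff_eventuallyEq_zero {M : ℝ} (hM : 0 < M) {z : E} (hz : 2 * M < ‖z‖) :
    (cutoff (E := E) M) =ᶠ[𝓝 z] fun _ => 0 := by
  have hopen : IsOpen {w : E | 2 * M < ‖w‖} := isOpen_lt continuous_const continuous_norm
  filter_upwards [hopen.mem_nhds hz] with w hw
  exact cutoff_eq_zero hM (le_of_lt hw)

omit [FiniteDimensional ℝ E] [MeasurableSpace E] [BorelSpace E] in
/-- The gradient of the cut-off vanishes outside the ball of radius `2M`. [folklore] -/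
theorem fderiv_cutoff_eq_zero_of_gt {M : ℝ} (hM : 0 < M) {z : E} (hz : 2 * M < ‖z‖) :
    fderiv ℝ (cutoff (E := E) M) z = 0 := by
  rw [(cutoff_eventuallyEq_zero hM hz).fderiv_eq]
  simp

/-! ### The truncated potential `Φ = χ_M P` and the Riesz–heat kernel `K = ∂ₐ∂ₐΦ` -/

/-- The truncated time-integrated heat kernel `Φ_{α,β,M} = χ_M · P_{α,β}` (`χ_M = cutoff M`,
`P = heatPot α β = ∫_{e^α}^{e^β} G_s ds`): smooth with compact support. [folklore] -/
def truncPot (α β M : ℝ) (z : E) : ℝ := cutoff M z * heatPot α β z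

/-- **The Riesz–heat kernel** `K = ∂ₐ∂ₐΦ_{α,β,M}`, the regularised kernel of `-∂ₐ∂ₐΔ⁻¹`
(Stein 1970, Ch. III §1.3: `∂ⱼ∂ₖf = -RⱼRₖΔf`, realised through `Δ⁻¹ = -∫₀^∞ e^{sΔ} ds`, §2).
[cite: Stein1971, Ch. III §1.3] -/
def rieszHeatKernel (α β M : ℝ) (a : E) (z : E) : ℝ :=
  fderiv ℝ (fun w => fderiv ℝ (truncPot α β M) w a) z a

section Kernel

variable {α β M : ℝ}

omit [MeasurableSpace E] [BorelSpace E] in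
/-- `Φ` is smooth. [folklore] -/
theorem contDiff_truncPot (α β M : ℝ) : ContDiff ℝ ∞ (truncPot (E := E) α β M) :=
  (contDiff_cutoff (n := ⊤) M).mul (contDiff_heatPot α β)

omit [MeasurableSpace E] [BorelSpace E] in
/-- `Φ` has compact support (`M > 0`). [folklore] -/
theorem hasCompactSupport_truncPot (α β : ℝ) (hM : 0 < M) :
    HasCompactSupport (truncPot (E := E) α β M) :=
  (hasCompactSupport_cutoff hM).mul_right

omit [MeasurableSpace E] [BorelSpace E] in
/-- `K` is continuous. [folklore] -/
theorem continuous_rieszHeatKernel (α β M : ℝ) (a : E) :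
    Continuous (rieszHeatKernel (E := E) α β M a) :=
  continuous_fderiv_fderiv_apply ((contDiff_truncPot α β M).of_le (by decide)) a a

omit [MeasurableSpace E] [BorelSpace E] in
/-- `K` has compact support (`M > 0`). [folklore] -/
theorem hasCompactSupport_rieszHeatKernel (α β : ℝ) (hM : 0 < M) (a : E) :
    HasCompactSupport (rieszHeatKernel (E := E) α β M a) :=
  hasCompactSupport_fderiv_fderiv_apply (hasCompactSupport_truncPot α β hM) a a

omit [MeasurableSpace E] [BorelSpace E] in
/-- `K` is bounded. [folklore] -/
theorem exists_abs_rieszHeatKernel_le (α β : ℝ) (hM : 0 < M) (a : E) :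
    ∃ M' : ℝ, ∀ z, |rieszHeatKernel (E := E) α β M a z| ≤ M' := by
  obtain ⟨C, hC⟩ := (continuous_rieszHeatKernel α β M a).bounded_above_of_compact_support
    (hasCompactSupport_rieszHeatKernel α β hM a)
  exact ⟨C, fun z => by rw [← Real.norm_eq_abs]; exact hC z⟩

/-- The `L¹` part of the kernel: `K₂ = 2 ∂ₐχ_M ∂ₐP + P ∂ₐ∂ₐχ_M`. [folklore] -/
def rieszHeatKernelErr (α β M : ℝ) (a : E) (z : E) : ℝ :=
  2 * (fderiv ℝ (cutoff M) z a * fderiv ℝ (heatPot α β) z a) +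
    heatPot α β z * fderiv ℝ (fun w => fderiv ℝ (cutoff (E := E) M) w a) z a

omit [MeasurableSpace E] [BorelSpace E] in
/-- **Decomposition of the kernel**: `K = χ_M ∂ₐ∂ₐP + K₂`. [folklore] -/
theorem rieszHeatKernel_eq_add (α β M : ℝ) (a : E) :
    rieszHeatKernel (E := E) α β M a =
      (fun z => cutoff M z * heatPotD2 α β a a z) + rieszHeatKernelErr α β M a := by
  funext z
  rw [rieszHeatKernel, Pi.add_apply, rieszHeatKernelErr]
  have h := fderiv_fderiv_mul_apply ((contDiff_cutoff (n := 2) M)) ((contDiff_heatPot α β).of_le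
    (by decide)) z a
  rw [fderiv_fderiv_heatPot_apply] at h
  show fderiv ℝ (fun w => fderiv ℝ (fun y => cutoff M y * heatPot α β y) w a) z a = _
  rw [h]
  ring

omit [MeasurableSpace E] [BorelSpace E] in
/-- The main part `χ_M ∂ₐ∂ₐP` is differentiable. [folklore] -/
theorem differentiable_cutoff_mul_heatPotD2 (α β M : ℝ) (a : E) :
    Differentiable ℝ fun z => cutoff (E := E) M z * heatPotD2 α β a a z :=
  ((contDiff_cutoff (n := 1) M).differentiable one_ne_zero).mul
    ((contDiff_heatPotD2 α β a a).differentiable (by simp))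

omit [MeasurableSpace E] [BorelSpace E] in
/-- `K₂` is continuous. [folklore] -/
theorem continuous_rieszHeatKernelErr (α β M : ℝ) (a : E) :
    Continuous (rieszHeatKernelErr (E := E) α β M a) := by
  unfold rieszHeatKernelErr
  have h1 : Continuous fun z => fderiv ℝ (cutoff (E := E) M) z a :=
    ((contDiff_cutoff (n := 1) M).continuous_fderiv one_ne_zero).clm_apply continuous_const
  have h2 : Continuous fun z => fderiv ℝ (heatPot (E := E) α β) z a :=
    ((contDiff_heatPot α β).continuous_fderiv (by simp)).clm_apply continuous_const
  have h3 : Continuous fun z => fderiv ℝ (fun w => fderiv ℝ (cutoff (E := E) M) w a) z a :=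
    continuous_fderiv_fderiv_apply (contDiff_cutoff (n := 2) M) a a
  exact (continuous_const.mul (h1.mul h2)).add ((contDiff_heatPot α β).continuous.mul h3)

omit [MeasurableSpace E] [BorelSpace E] in
/-- **Gradient bound for the main part of the kernel** (the hypothesis `|∇K| ≤ C|x|^{-n-1}` of
Stein 1970, Ch. II §2.2 (2), uniformly in `ε, R, M`): with `C_D, C_T` the constants of the
parabolic bounds, `C_χ` the gradient constant of the cut-off and `|a| ≤ 2`, for `z ≠ 0`,
`‖∇(χ_M ∂ₐ∂ₐP)(z)‖ ≤ 4 (2C_T/(n+1) + 4 C_χ C_D / n) |z|^{-(n+1)}`. [cite: Stein1971, Ch. II §2.2 (2)] -/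
theorem norm_fderiv_cutoff_mul_heatPotD2_le (hn : 1 ≤ Module.finrank ℝ E)
    {C_D : ℝ} (hC_D : 0 < C_D) (hD : ∀ {s : ℝ}, 0 < s → ∀ a b z : E, |heatKernelD2 s a b z| ≤
      C_D * ‖a‖ * ‖b‖ * (s + ‖z‖ ^ 2) ^ (-(((Module.finrank ℝ E : ℝ) + 2) / 2)))
    {C_T : ℝ} (hC_T : 0 < C_T) (hT : ∀ {s : ℝ}, 0 < s → ∀ z a b : E, ‖oseenIntegrand s z a b‖ ≤
      C_T * ‖a‖ * ‖b‖ * (s + ‖z‖ ^ 2) ^ (-(((Module.finrank ℝ E : ℝ) + 3) / 2)))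
    {C_χ : ℝ} (hC_χ : 0 ≤ C_χ) (hχ : ∀ R : ℝ, 0 < R → ∀ x : E, ‖fderiv ℝ (cutoff R) x‖ ≤ C_χ / R)
    (hαβ : α ≤ β) (hM : 0 < M) {a : E} (ha : ‖a‖ ≤ 2) {z : E} (hz : z ≠ 0) :
    ‖fderiv ℝ (fun z => cutoff (E := E) M z * heatPotD2 α β a a z) z‖ ≤
      (4 * (2 * C_T / (Module.finrank ℝ E + 1) + 4 * C_χ * C_D / Module.finrank ℝ E)) *
        ‖z‖ ^ (-((Module.finrank ℝ E : ℝ) + 1)) := by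
  set n : ℝ := (Module.finrank ℝ E : ℝ) with hn_def
  have hn1 : (1 : ℝ) ≤ n := by rw [hn_def]; exact_mod_cast hn
  have hn0 : (0 : ℝ) < n := by linarith
  have hzpos : 0 < ‖z‖ := norm_pos_iff.2 hz
  have ha2 : ‖a‖ ^ 2 ≤ 4 := by nlinarith [norm_nonneg a]
  have hθd : DifferentiableAt ℝ (cutoff (E := E) M) z :=
    (contDiff_cutoff (n := 1) M).differentiable one_ne_zero z
  have hDd : DifferentiableAt ℝ (heatPotD2 (E := E) α β a a) z :=
    (contDiff_heatPotD2 α β a a).differentiable (by simp) z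
  rw [fderiv_fun_mul hθd hDd]
  -- the two terms
  have hD2 : |heatPotD2 α β a a z| ≤ (2 * C_D / n) * ‖a‖ * ‖a‖ * ‖z‖ ^ (-n) :=
    abs_heatPotD2_le hn hC_D hD hαβ a a hz
  have hD3 : ‖fderiv ℝ (heatPotD2 α β a a) z‖ ≤ (2 * C_T / (n + 1)) * ‖a‖ * ‖a‖ * ‖z‖ ^ (-(n + 1)) :=
    norm_fderiv_heatPotD2_le hC_T hT hαβ a a hz
  have hθ1 : |cutoff (E := E) M z| ≤ 1 := abs_cutoff_le_one M z
  -- term 1: `χ ∇(∂ₐ∂ₐP)`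
  have hT1 : ‖cutoff (E := E) M z • fderiv ℝ (heatPotD2 α β a a) z‖ ≤
      4 * (2 * C_T / (n + 1)) * ‖z‖ ^ (-(n + 1)) := by
    rw [norm_smul, Real.norm_eq_abs]
    calc |cutoff (E := E) M z| * ‖fderiv ℝ (heatPotD2 α β a a) z‖
        ≤ 1 * ((2 * C_T / (n + 1)) * ‖a‖ * ‖a‖ * ‖z‖ ^ (-(n + 1))) :=
          mul_le_mul hθ1 hD3 (norm_nonneg _) zero_le_one
      _ = (2 * C_T / (n + 1)) * ‖a‖ ^ 2 * ‖z‖ ^ (-(n + 1)) := by ring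
      _ ≤ (2 * C_T / (n + 1)) * 4 * ‖z‖ ^ (-(n + 1)) := by gcongr
      _ = 4 * (2 * C_T / (n + 1)) * ‖z‖ ^ (-(n + 1)) := by ring
  -- term 2: `(∂ₐ∂ₐP) ∇χ`, non-zero only for `|z| ≤ 2M`, where `1/M ≤ 2/|z|`
  have hT2 : ‖heatPotD2 α β a a z • fderiv ℝ (cutoff (E := E) M) z‖ ≤
      4 * (4 * C_χ * C_D / n) * ‖z‖ ^ (-(n + 1)) := by
    rcases lt_or_ge (2 * M) ‖z‖ with hfar | hnear
    · rw [fderiv_cutoff_eq_zero_of_gt hM hfar, smul_zero, norm_zero]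
      positivity
    · rw [norm_smul, Real.norm_eq_abs]
      have hχz : ‖fderiv ℝ (cutoff (E := E) M) z‖ ≤ 2 * C_χ * ‖z‖ ^ (-(1 : ℝ)) := by
        refine (hχ M hM z).trans ?_
        rw [Real.rpow_neg_one, ← div_eq_mul_inv]
        rw [div_le_div_iff₀ hM hzpos]
        nlinarith
      calc |heatPotD2 α β a a z| * ‖fderiv ℝ (cutoff (E := E) M) z‖
          ≤ ((2 * C_D / n) * ‖a‖ * ‖a‖ * ‖z‖ ^ (-n)) * (2 * C_χ * ‖z‖ ^ (-(1 : ℝ))) :=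
            mul_le_mul hD2 hχz (norm_nonneg _) (by positivity)
        _ = (4 * C_χ * C_D / n) * ‖a‖ ^ 2 * (‖z‖ ^ (-n) * ‖z‖ ^ (-(1 : ℝ))) := by ring
        _ = (4 * C_χ * C_D / n) * ‖a‖ ^ 2 * ‖z‖ ^ (-(n + 1)) := by
            rw [← Real.rpow_add hzpos]; congr 2; ring
        _ ≤ (4 * C_χ * C_D / n) * 4 * ‖z‖ ^ (-(n + 1)) := by gcongr
        _ = 4 * (4 * C_χ * C_D / n) * ‖z‖ ^ (-(n + 1)) := by ring
  calc ‖cutoff (E := E) M z • fderiv ℝ (heatPotD2 α β a a) z +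
        heatPotD2 α β a a z • fderiv ℝ (cutoff (E := E) M) z‖
      ≤ ‖cutoff (E := E) M z • fderiv ℝ (heatPotD2 α β a a) z‖ +
          ‖heatPotD2 α β a a z • fderiv ℝ (cutoff (E := E) M) z‖ := norm_add_le _ _
    _ ≤ 4 * (2 * C_T / (n + 1)) * ‖z‖ ^ (-(n + 1)) + 4 * (4 * C_χ * C_D / n) * ‖z‖ ^ (-(n + 1)) :=
        add_le_add hT1 hT2
    _ = (4 * (2 * C_T / (n + 1) + 4 * C_χ * C_D / n)) * ‖z‖ ^ (-(n + 1)) := by ring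

/-- **The error part is `L¹`-small**: for `|a| ≤ 2`,
`‖K₂‖₁ ≤ (8C_χ/M) ‖∇P‖₁ + (4C_χ'/M²) ‖P‖₁`. [folklore] -/
theorem lintegral_enorm_rieszHeatKernelErr_le
    {C_χ : ℝ} (hC_χ : 0 ≤ C_χ) (hχ : ∀ R : ℝ, 0 < R → ∀ x : E, ‖fderiv ℝ (cutoff R) x‖ ≤ C_χ / R)
    {C_χ' : ℝ} (hC_χ' : 0 ≤ C_χ')
    (hχ' : ∀ R : ℝ, 0 < R → ∀ x : E, ‖fderiv ℝ (fderiv ℝ (cutoff R)) x‖ ≤ C_χ' / R ^ 2)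
    (α β : ℝ) (hM : 0 < M) {a : E} (ha : ‖a‖ ≤ 2) :
    ∫⁻ z, ‖rieszHeatKernelErr (E := E) α β M a z‖ₑ ≤
      ENNReal.ofReal (4 * C_χ' / M ^ 2) * (∫⁻ z, ‖heatPot (E := E) α β z‖ₑ) +
        ENNReal.ofReal (8 * C_χ / M) * ∫⁻ z, ‖fderiv ℝ (heatPot (E := E) α β) z‖ₑ := by
  have ha2 : ‖a‖ ^ 2 ≤ 4 := by nlinarith [norm_nonneg a]
  have hpt : ∀ z, ‖rieszHeatKernelErr (E := E) α β M a z‖ₑ ≤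
      ENNReal.ofReal (4 * C_χ' / M ^ 2) * ‖heatPot (E := E) α β z‖ₑ +
        ENNReal.ofReal (8 * C_χ / M) * ‖fderiv ℝ (heatPot (E := E) α β) z‖ₑ := by
    intro z
    have h1 : |2 * (fderiv ℝ (cutoff M) z a * fderiv ℝ (heatPot α β) z a)| ≤
        (8 * C_χ / M) * ‖fderiv ℝ (heatPot (E := E) α β) z‖ := by
      rw [abs_mul, abs_two, abs_mul]
      have e1 : |fderiv ℝ (cutoff (E := E) M) z a| ≤ C_χ / M * ‖a‖ := by
        rw [← Real.norm_eq_abs]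
        exact ((fderiv ℝ (cutoff M) z).le_opNorm a).trans
          (mul_le_mul_of_nonneg_right (hχ M hM z) (norm_nonneg a))
      have e2 : |fderiv ℝ (heatPot (E := E) α β) z a| ≤ ‖fderiv ℝ (heatPot (E := E) α β) z‖ * ‖a‖ := by
        rw [← Real.norm_eq_abs]; exact (fderiv ℝ (heatPot α β) z).le_opNorm a
      calc 2 * (|fderiv ℝ (cutoff M) z a| * |fderiv ℝ (heatPot α β) z a|)
          ≤ 2 * ((C_χ / M * ‖a‖) * (‖fderiv ℝ (heatPot (E := E) α β) z‖ * ‖a‖)) :=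
            mul_le_mul_of_nonneg_left (mul_le_mul e1 e2 (abs_nonneg _) (by positivity)) zero_le_two
        _ = 2 * (C_χ / M) * ‖a‖ ^ 2 * ‖fderiv ℝ (heatPot (E := E) α β) z‖ := by ring
        _ ≤ 2 * (C_χ / M) * 4 * ‖fderiv ℝ (heatPot (E := E) α β) z‖ := by gcongr
        _ = (8 * C_χ / M) * ‖fderiv ℝ (heatPot (E := E) α β) z‖ := by ring
    have h2 : |heatPot α β z * fderiv ℝ (fun w => fderiv ℝ (cutoff (E := E) M) w a) z a| ≤
        (4 * C_χ' / M ^ 2) * |heatPot (E := E) α β z| := by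
      rw [abs_mul]
      have e3 := abs_fderiv_fderiv_apply_le (contDiff_cutoff (n := 2) M) z a
      calc |heatPot α β z| * |fderiv ℝ (fun w => fderiv ℝ (cutoff (E := E) M) w a) z a|
          ≤ |heatPot α β z| * (C_χ' / M ^ 2 * ‖a‖ ^ 2) :=
            mul_le_mul_of_nonneg_left (e3.trans (mul_le_mul_of_nonneg_right (hχ' M hM z)
              (sq_nonneg _))) (abs_nonneg _)
        _ ≤ |heatPot α β z| * (C_χ' / M ^ 2 * 4) := by gcongr
        _ = (4 * C_χ' / M ^ 2) * |heatPot (E := E) α β z| := by ring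
    rw [rieszHeatKernelErr, Real.enorm_eq_ofReal_abs, Real.enorm_eq_ofReal_abs,
      ← ofReal_norm, ← ENNReal.ofReal_mul (by positivity), ← ENNReal.ofReal_mul (by positivity),
      ← ENNReal.ofReal_add (by positivity) (by positivity)]
    refine ENNReal.ofReal_le_ofReal ((abs_add_le _ _).trans ?_)
    linarith
  have hm : Measurable fun z => ENNReal.ofReal (4 * C_χ' / M ^ 2) * ‖heatPot (E := E) α β z‖ₑ :=
    ((contDiff_heatPot α β).continuous.measurable.enorm).const_mul _
  calc ∫⁻ z, ‖rieszHeatKernelErr (E := E) α β M a z‖ₑ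
      ≤ ∫⁻ z, ENNReal.ofReal (4 * C_χ' / M ^ 2) * ‖heatPot (E := E) α β z‖ₑ +
          ENNReal.ofReal (8 * C_χ / M) * ‖fderiv ℝ (heatPot (E := E) α β) z‖ₑ := lintegral_mono hpt
    _ = _ := by
        rw [lintegral_add_left hm, lintegral_const_mul' _ _ ENNReal.ofReal_ne_top,
          lintegral_const_mul' _ _ ENNReal.ofReal_ne_top]

/-- **`L¹` bound for the Laplacian of the truncated potential**:
`‖ΔΦ‖₁ ≤ 2 + (nC_χ'/M²)‖P‖₁ + (2C_χ/M)‖∇P‖₁` (`ΔP = G_R - G_ε` has `L¹` norm at most `2`).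
[folklore] -/
theorem lintegral_enorm_laplacian_truncPot_le
    {C_χ : ℝ} (hC_χ : 0 ≤ C_χ) (hχ : ∀ R : ℝ, 0 < R → ∀ x : E, ‖fderiv ℝ (cutoff R) x‖ ≤ C_χ / R)
    {C_χ' : ℝ} (hC_χ' : 0 ≤ C_χ')
    (hχ' : ∀ R : ℝ, 0 < R → ∀ x : E, ‖fderiv ℝ (fderiv ℝ (cutoff R)) x‖ ≤ C_χ' / R ^ 2)
    (α β : ℝ) (hM : 0 < M) :
    ∫⁻ z, ‖(Δ (truncPot (E := E) α β M)) z‖ₑ ≤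
      2 + ENNReal.ofReal (Module.finrank ℝ E * C_χ' / M ^ 2) * (∫⁻ z, ‖heatPot (E := E) α β z‖ₑ) +
        ENNReal.ofReal (2 * C_χ / M) * ∫⁻ z, ‖fderiv ℝ (heatPot (E := E) α β) z‖ₑ := by
  set n := Module.finrank ℝ E with hn_def
  set b := stdOrthonormalBasis ℝ E with hb
  have hθ2 : ContDiff ℝ 2 (cutoff (E := E) M) := contDiff_cutoff (n := 2) M
  have hP2 : ContDiff ℝ 2 (heatPot (E := E) α β) := (contDiff_heatPot α β).of_le (by decide)
  -- pointwise: `|ΔΦ| ≤ |ΔP| + (n C_χ'/M²)|P| + (2C_χ/M)‖∇P‖`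
  have hpt : ∀ z, ‖(Δ (truncPot (E := E) α β M)) z‖ₑ ≤
      ‖(Δ (heatPot (E := E) α β)) z‖ₑ +
        ENNReal.ofReal (n * C_χ' / M ^ 2) * ‖heatPot (E := E) α β z‖ₑ +
          ENNReal.ofReal (2 * C_χ / M) * ‖fderiv ℝ (heatPot (E := E) α β) z‖ₑ := by
    intro z
    have hΔ : (Δ (truncPot (E := E) α β M)) z = cutoff M z * (Δ (heatPot (E := E) α β)) z +
        heatPot α β z * (Δ (cutoff (E := E) M)) z +
          2 * ∑ i, fderiv ℝ (cutoff (E := E) M) z (b i) * fderiv ℝ (heatPot α β) z (b i) := by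
      show (Δ fun y => cutoff (E := E) M y * heatPot α β y) z = _
      exact laplacian_mul_eq b hθ2 hP2 z
    have h1 : |cutoff M z * (Δ (heatPot (E := E) α β)) z| ≤ |(Δ (heatPot (E := E) α β)) z| := by
      rw [abs_mul]
      exact mul_le_of_le_one_left (abs_nonneg _) (abs_cutoff_le_one M z)
    have h2 : |heatPot α β z * (Δ (cutoff (E := E) M)) z| ≤ (n * C_χ' / M ^ 2) * |heatPot (E := E) α β z| := by
      rw [abs_mul]
      calc |heatPot α β z| * |(Δ (cutoff (E := E) M)) z|
          ≤ |heatPot α β z| * (n * (C_χ' / M ^ 2)) :=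
            mul_le_mul_of_nonneg_left ((abs_laplacian_le_finrank_mul_norm hθ2 z).trans
              (mul_le_mul_of_nonneg_left (hχ' M hM z) (Nat.cast_nonneg _))) (abs_nonneg _)
        _ = (n * C_χ' / M ^ 2) * |heatPot (E := E) α β z| := by ring
    have h3 : |2 * ∑ i, fderiv ℝ (cutoff (E := E) M) z (b i) * fderiv ℝ (heatPot α β) z (b i)| ≤
        (2 * C_χ / M) * ‖fderiv ℝ (heatPot (E := E) α β) z‖ := by
      rw [abs_mul, abs_two]
      calc 2 * |∑ i, fderiv ℝ (cutoff (E := E) M) z (b i) * fderiv ℝ (heatPot α β) z (b i)|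
          ≤ 2 * (‖fderiv ℝ (cutoff (E := E) M) z‖ * ‖fderiv ℝ (heatPot α β) z‖) := by
            gcongr; exact abs_sum_fderiv_mul_fderiv_le b _ _ z
        _ ≤ 2 * ((C_χ / M) * ‖fderiv ℝ (heatPot α β) z‖) := by
            gcongr; exact hχ M hM z
        _ = (2 * C_χ / M) * ‖fderiv ℝ (heatPot (E := E) α β) z‖ := by ring
    rw [hΔ, Real.enorm_eq_ofReal_abs, Real.enorm_eq_ofReal_abs, Real.enorm_eq_ofReal_abs,
      ← ofReal_norm, ← ENNReal.ofReal_mul (by positivity), ← ENNReal.ofReal_mul (by positivity),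
      ← ENNReal.ofReal_add (by positivity) (by positivity),
      ← ENNReal.ofReal_add (by positivity) (by positivity)]
    refine ENNReal.ofReal_le_ofReal ?_
    calc |cutoff M z * (Δ (heatPot (E := E) α β)) z + heatPot α β z * (Δ (cutoff (E := E) M)) z +
          2 * ∑ i, fderiv ℝ (cutoff (E := E) M) z (b i) * fderiv ℝ (heatPot α β) z (b i)|
        ≤ |cutoff M z * (Δ (heatPot (E := E) α β)) z| + |heatPot α β z * (Δ (cutoff (E := E) M)) z| +
          |2 * ∑ i, fderiv ℝ (cutoff (E := E) M) z (b i) * fderiv ℝ (heatPot α β) z (b i)| :=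
          abs_add_three _ _ _
      _ ≤ _ := add_le_add (add_le_add h1 h2) h3
  -- `‖ΔP‖₁ ≤ 2`
  have hΔP : ∫⁻ z, ‖(Δ (heatPot (E := E) α β)) z‖ₑ ≤ 2 := by
    have e : ∀ z, (Δ (heatPot (E := E) α β)) z = heatKernel (Real.exp β) z - heatKernel (Real.exp α) z :=
      fun z => laplacian_heatPot α β z
    simp_rw [e]
    calc ∫⁻ z, ‖heatKernel (Real.exp β) z - heatKernel (Real.exp α) z‖ₑ
        ≤ ∫⁻ z, ‖heatKernel (E := E) (Real.exp β) z‖ₑ + ‖heatKernel (E := E) (Real.exp α) z‖ₑ :=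
          lintegral_mono fun z => enorm_sub_le
      _ = (∫⁻ z, ‖heatKernel (E := E) (Real.exp β) z‖ₑ) + ∫⁻ z, ‖heatKernel (E := E) (Real.exp α) z‖ₑ :=
          lintegral_add_left (UnboundedOperators.continuous_heatKernel _).measurable.enorm _
      _ = 1 + 1 := by
          rw [UnboundedOperators.lintegral_enorm_heatKernel (Real.exp_pos β),
            UnboundedOperators.lintegral_enorm_heatKernel (Real.exp_pos α)]
      _ = 2 := one_add_one_eq_two
  have hmeasP : Measurable fun z => ‖(Δ (heatPot (E := E) α β)) z‖ₑ :=
    (continuous_laplacian hP2).measurable.enorm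
  have hmeas1 : Measurable fun z => ENNReal.ofReal (n * C_χ' / M ^ 2) * ‖heatPot (E := E) α β z‖ₑ :=
    ((contDiff_heatPot α β).continuous.measurable.enorm).const_mul _
  calc ∫⁻ z, ‖(Δ (truncPot (E := E) α β M)) z‖ₑ
      ≤ ∫⁻ z, ‖(Δ (heatPot (E := E) α β)) z‖ₑ +
          ENNReal.ofReal (n * C_χ' / M ^ 2) * ‖heatPot (E := E) α β z‖ₑ +
            ENNReal.ofReal (2 * C_χ / M) * ‖fderiv ℝ (heatPot (E := E) α β) z‖ₑ := lintegral_mono hpt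
    _ = (∫⁻ z, ‖(Δ (heatPot (E := E) α β)) z‖ₑ) +
          ENNReal.ofReal (n * C_χ' / M ^ 2) * (∫⁻ z, ‖heatPot (E := E) α β z‖ₑ) +
            ENNReal.ofReal (2 * C_χ / M) * ∫⁻ z, ‖fderiv ℝ (heatPot (E := E) α β) z‖ₑ := by
        have hmeas2 : Measurable fun z => ‖(Δ (heatPot (E := E) α β)) z‖ₑ +
            ENNReal.ofReal (n * C_χ' / M ^ 2) * ‖heatPot (E := E) α β z‖ₑ := hmeasP.add hmeas1
        rw [lintegral_add_left hmeas2, lintegral_add_left hmeasP,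
          lintegral_const_mul' _ _ ENNReal.ofReal_ne_top, lintegral_const_mul' _ _ ENNReal.ofReal_ne_top]
    _ ≤ 2 + ENNReal.ofReal (n * C_χ' / M ^ 2) * (∫⁻ z, ‖heatPot (E := E) α β z‖ₑ) +
            ENNReal.ofReal (2 * C_χ / M) * ∫⁻ z, ‖fderiv ℝ (heatPot (E := E) α β) z‖ₑ := by
        gcongr

/-- **The `L²` bound** (Stein 1970, Ch. III §1.3 for `p = 2`, here for the regularised kernel):
if `‖ΔΦ‖₁ ≤ 3` then `‖K * h‖₂ ≤ 12 ‖h‖₂` for `h ∈ C_c`, `|a| ≤ 2`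
(`K * h = ∂ₐ∂ₐ(Φ * h)`, `‖∂ₐ∂ₐ u‖₂ ≤ |a|² ‖Δu‖₂` for `u ∈ C^∞_c` by two integrations by parts, and
`Δ(Φ * h) = ΔΦ * h`, Young). [cite: Stein1971, Ch. III §1.3 Prop 3] -/
theorem eLpNorm_conv_rieszHeatKernel_le (α β : ℝ) (hM : 0 < M)
    (h3 : ∫⁻ z, ‖(Δ (truncPot (E := E) α β M)) z‖ₑ ≤ 3) {a : E} (ha : ‖a‖ ≤ 2) {h : E → ℝ}
    (hh : Continuous h) (hhc : HasCompactSupport h) :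
    eLpNorm (fun x => ∫ t, h t * rieszHeatKernel α β M a (x - t)) 2 volume ≤
      (12 : ℝ≥0) * eLpNorm h 2 volume := by
  set Φ := truncPot (E := E) α β M with hΦ
  have hΦs : ContDiff ℝ ∞ Φ := contDiff_truncPot α β M
  have hΦc : HasCompactSupport Φ := hasCompactSupport_truncPot α β hM
  set U := h ⋆[ContinuousLinearMap.lsmul ℝ ℝ, volume] Φ with hU
  have hUs : ContDiff ℝ ∞ U := hΦc.contDiff_convolution_right _ hh.locallyIntegrable hΦs
  have hUc : HasCompactSupport U := hhc.convolution _ hΦc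
  have hU3 : ContDiff ℝ 3 U := hUs.of_le (by decide)
  have hU2 : ContDiff ℝ 2 U := hUs.of_le (by decide)
  -- `T h = ∂ₐ∂ₐU`
  have hT : (fun x => ∫ t, h t * rieszHeatKernel α β M a (x - t)) =
      fun x => fderiv ℝ (fun y => fderiv ℝ U y a) x a := by
    funext x
    rw [fderiv_fderiv_conv_apply hh hΦs hΦc x a]
    rfl
  -- `ΔU = (ΔΦ) * h`
  have hΔU : (Δ U) = (Δ Φ) ⋆[ContinuousLinearMap.lsmul ℝ ℝ, volume] h := by
    funext x
    rw [laplacian_conv hh hhc hΦs hΦc x, conv_lsmul_apply, integral_mul_comp_sub_comm]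
  have hΔΦc : Continuous (Δ Φ) := continuous_laplacian (hΦs.of_le (by decide))
  -- the `L²` comparison `‖∂ₐ∂ₐU‖₂ ≤ |a|² ‖ΔU‖₂`
  have hm1 : MemLp (fun x => fderiv ℝ (fun y => fderiv ℝ U y a) x a) 2 volume :=
    (continuous_fderiv_fderiv_apply hU2 a a).memLp_of_hasCompactSupport
      (hasCompactSupport_fderiv_fderiv_apply hUc a a)
  have hm2 : MemLp (Δ U) 2 volume :=
    (continuous_laplacian hU2).memLp_of_hasCompactSupport
      (HasCompactSupport.intro hUc fun x hx => laplacian_eq_zero_of_notMem_tsupport hx)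
  have hsq : ∫ x, (fderiv ℝ (fun y => fderiv ℝ U y a) x a) ^ 2 ≤ (‖a‖ ^ 2) ^ 2 * ∫ x, ((Δ U) x) ^ 2 := by
    rw [← pow_mul]
    exact integral_sq_fderiv_fderiv_apply_le hU3 hUc a
  have ha2 : ‖a‖ ^ 2 ≤ 4 := by nlinarith [norm_nonneg a]
  rw [hT]
  calc eLpNorm (fun x => fderiv ℝ (fun y => fderiv ℝ U y a) x a) 2 volume
      ≤ ENNReal.ofReal (‖a‖ ^ 2) * eLpNorm (Δ U) 2 volume :=
        eLpNorm_two_le_of_integral_sq_le hm1 hm2 (sq_nonneg _) hsq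
    _ = ENNReal.ofReal (‖a‖ ^ 2) * eLpNorm ((Δ Φ) ⋆[ContinuousLinearMap.lsmul ℝ ℝ, volume] h) 2 volume := by
        rw [hΔU]
    _ ≤ ENNReal.ofReal (‖a‖ ^ 2) * ((∫⁻ z, ‖(Δ Φ) z‖ₑ) * eLpNorm h 2 volume) := by
        gcongr
        exact UnboundedOperators.eLpNorm_convolution_le_lintegral_enorm_mul hΔΦc.aestronglyMeasurable
          hh.aestronglyMeasurable one_le_two
    _ ≤ ENNReal.ofReal 4 * (3 * eLpNorm h 2 volume) := by
        gcongr
    _ = (12 : ℝ≥0) * eLpNorm h 2 volume := by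
        rw [ENNReal.ofReal_ofNat, ← mul_assoc]
        norm_num

end Kernel

/-! ### The representation `(K * Δf)(x) = e^{RΔ}(∂ₐ∂ₐf)(x) - e^{εΔ}(∂ₐ∂ₐf)(x)` -/

section Representation

variable {α β M : ℝ}

/-- The heat extension as an integral against the translated kernel:
`e^{sΔ}φ(x) = ∫ G_s(x - t) φ(t) dt`. [folklore] -/
theorem heatExtension_eq_integral_mul (φ : E → ℝ) (s : ℝ) (x : E) :
    heatExtension φ s x = ∫ t, heatKernel s (x - t) * φ t := by
  rw [UnboundedOperators.heatExtension_apply]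
  have e := (integral_sub_left_eq_self (fun y => heatKernel (E := E) s y • φ (x - y)) volume x).symm
  simp only [sub_sub_cancel, smul_eq_mul] at e
  exact e

/-- **The regularised Riesz identity** (Stein 1970, Ch. III §1.3, `∂ₐ∂ₐ = -RₐRₐΔ`, through the
heat semigroup): for `f ∈ C²_c` supported in `B̄(0, ρ)`, `M > |x| + ρ` and `ε = e^α ≤ R = e^β`,
`∫ Δf(t) K(x - t) dt = e^{RΔ}(∂ₐ∂ₐf)(x) - e^{εΔ}(∂ₐ∂ₐf)(x)`
(Green's second identity, `Δ∂ₐ∂ₐΦ = ∂ₐ∂ₐΔΦ`, two integrations by parts, and `ΔΦ = ΔP = G_R - G_ε`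
at the points `x - t`, `t ∈ supp f`, where `χ_M ≡ 1`). [cite: Stein1971, Ch. III §1.3] -/
theorem integral_laplacian_mul_rieszHeatKernel (α β : ℝ) (hM : 0 < M) {f : E → ℝ}
    (hf : ContDiff ℝ 2 f) (hfc : HasCompactSupport f) {ρ : ℝ} (hρ : tsupport f ⊆ closedBall 0 ρ)
    {x : E} (hx : ‖x‖ + ρ < M) (a : E) :
    ∫ t, (Δ f) t * rieszHeatKernel α β M a (x - t) =
      heatExtension (fun z => fderiv ℝ (fun w => fderiv ℝ f w a) z a) (Real.exp β) x -
        heatExtension (fun z => fderiv ℝ (fun w => fderiv ℝ f w a) z a) (Real.exp α) x := by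
  set Φ := truncPot (E := E) α β M with hΦ
  set K := rieszHeatKernel (E := E) α β M a with hK
  set φ : E → ℝ := fun z => fderiv ℝ (fun w => fderiv ℝ f w a) z a with hφ
  have hΦs : ContDiff ℝ ∞ Φ := contDiff_truncPot α β M
  have hΦ4 : ContDiff ℝ 4 Φ := hΦs.of_le (by decide)
  have hΦ3 : ContDiff ℝ 3 Φ := hΦs.of_le (by decide)
  have hg3 : ContDiff ℝ 3 (fun s => fderiv ℝ Φ s a) :=
    (hΦ4.fderiv_right (m := 3) (by norm_num)).clm_apply contDiff_const
  have hK2 : ContDiff ℝ 2 K := (hg3.fderiv_right (m := 2) (by norm_num)).clm_apply contDiff_const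
  have hΔΦ2 : ContDiff ℝ 2 (Δ Φ) := contDiff_laplacian (n := 2) (by exact_mod_cast hΦ4)
  -- Step 1: Green's second identity
  have s1 : ∫ t, (Δ f) t * K (x - t) = ∫ t, f t * (Δ (fun z => K (x - z))) t := by
    have h := integral_inner_laplacian_comm (v := fun z => K (x - z)) (w := f)
      (contDiff_comp_const_sub hK2 x) hf hfc
    simp only [RCLike.inner_apply, conj_trivial] at h
    exact h.symm
  -- Step 2: `Δ` commutes with the reflection-translation
  have s2 : ∀ t, (Δ (fun z => K (x - z))) t = (Δ K) (x - t) := fun t => laplacian_comp_sub_left hK2 x t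
  -- Step 3: `Δ∂ₐ∂ₐΦ = ∂ₐ∂ₐΔΦ`
  have s3 : ∀ z, (Δ K) z = fderiv ℝ (fun s => fderiv ℝ (Δ Φ) s a) z a := by
    intro z
    have e1 : (Δ (fun s => fderiv ℝ Φ s a)) = fun s => fderiv ℝ (Δ Φ) s a :=
      funext fun s => (fderiv_laplacian_apply hΦ3 s a).symm
    have hKdef : K = fun z => fderiv ℝ (fun w => fderiv ℝ Φ w a) z a := rfl
    rw [hKdef, ← fderiv_laplacian_apply hg3 z a, e1]
  -- Step 4: two integrations by parts back onto `f`
  have s4 : ∫ t, f t * fderiv ℝ (fun s => fderiv ℝ (Δ Φ) s a) (x - t) a = ∫ t, (Δ Φ) (x - t) * φ t := by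
    rw [integral_comp_sub_mul_fderiv_fderiv_apply hΔΦ2 hf hfc x a]
    exact integral_congr_ae (Eventually.of_forall fun t => mul_comm _ _)
  -- Step 5: at the relevant points `ΔΦ = G_R - G_ε`
  have s5 : ∀ t, (Δ Φ) (x - t) * φ t = (heatKernel (Real.exp β) (x - t) - heatKernel (Real.exp α) (x - t)) * φ t := by
    intro t
    by_cases ht : φ t = 0
    · rw [ht, mul_zero, mul_zero]
    have htf : t ∈ tsupport f := by
      by_contra h
      exact ht (fderiv_fderiv_apply_eq_zero_of_notMem_tsupport h a)
    have htρ : ‖t‖ ≤ ρ := mem_closedBall_zero_iff.1 (hρ htf)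
    have hxt : ‖x - t‖ < M := by
      have := norm_sub_le x t
      linarith
    have hloc : Φ =ᶠ[𝓝 (x - t)] heatPot α β := by
      filter_upwards [cutoff_eventuallyEq_one hM hxt] with w hw
      show cutoff M w * heatPot α β w = heatPot α β w
      rw [hw, one_mul]
    rw [(laplacian_congr_nhds hloc).self_of_nhds, laplacian_heatPot]
  -- Step 6: the two heat extensions
  have hφc : Continuous φ := continuous_fderiv_fderiv_apply hf a a
  have hφcs : HasCompactSupport φ := hasCompactSupport_fderiv_fderiv_apply hfc a a
  have hint : ∀ s : ℝ, Integrable fun t => heatKernel s (x - t) * φ t := fun s =>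
    (((UnboundedOperators.continuous_heatKernel s).comp (continuous_const.sub continuous_id)).mul
      hφc).integrable_of_hasCompactSupport hφcs.mul_left
  calc ∫ t, (Δ f) t * K (x - t) = ∫ t, f t * (Δ K) (x - t) := by
        rw [s1]
        exact integral_congr_ae (Eventually.of_forall fun t => by dsimp only; rw [s2])
    _ = ∫ t, f t * fderiv ℝ (fun s => fderiv ℝ (Δ Φ) s a) (x - t) a :=
        integral_congr_ae (Eventually.of_forall fun t => by dsimp only; rw [s3])
    _ = ∫ t, (Δ Φ) (x - t) * φ t := s4
    _ = ∫ t, (heatKernel (Real.exp β) (x - t) - heatKernel (Real.exp α) (x - t)) * φ t :=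
        integral_congr_ae (Eventually.of_forall s5)
    _ = (∫ t, heatKernel (Real.exp β) (x - t) * φ t) - ∫ t, heatKernel (Real.exp α) (x - t) * φ t := by
        rw [← integral_sub (hint _) (hint _)]
        exact integral_congr_ae (Eventually.of_forall fun t => by ring)
    _ = heatExtension φ (Real.exp β) x - heatExtension φ (Real.exp α) x := by
        rw [heatExtension_eq_integral_mul, heatExtension_eq_integral_mul]

/-- **The limit of the regularised identity**: along `m → ∞`,
`e^{e^m Δ}φ(x) - e^{e^{-m} Δ}φ(x) → -φ(x)` for `φ ∈ C_c` (positive dimension: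
`e^{RΔ}φ → 0` as `R → ∞` for `φ ∈ L¹`, `e^{εΔ}φ → φ` as `ε → 0⁺` for bounded continuous `φ`;
Evans, *PDE*, §2.3.1 Thm. 1). [cite: Evans2010, §2.3.1 Theorem 1(iii)] -/
theorem tendsto_heatExtension_exp_sub (hn : 0 < Module.finrank ℝ E) {φ : E → ℝ} (hφ : Continuous φ)
    (hφc : HasCompactSupport φ) (x : E) :
    Tendsto (fun m : ℕ => heatExtension φ (Real.exp m) x - heatExtension φ (Real.exp (-(m : ℝ))) x)
      atTop (𝓝 (-φ x)) := by
  have h1 : Tendsto (fun m : ℕ => heatExtension φ (Real.exp m) x) atTop (𝓝 0) := by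
    have h := (tendsto_heatExtension_atTop_of_integrable (hφ.integrable_of_hasCompactSupport hφc) hn x).comp
      (Real.tendsto_exp_atTop.comp tendsto_natCast_atTop_atTop)
    exact h
  obtain ⟨C, hC⟩ := hφ.bounded_above_of_compact_support hφc
  have h2 : Tendsto (fun m : ℕ => heatExtension φ (Real.exp (-(m : ℝ))) x) atTop (𝓝 (φ x)) := by
    have hq : Tendsto (fun m : ℕ => ((Real.exp (-(m : ℝ)), x) : ℝ × E)) atTop
        (𝓝[Ioi 0 ×ˢ univ] ((0 : ℝ), x)) := by
      have he : Tendsto (fun m : ℕ => Real.exp (-(m : ℝ))) atTop (𝓝 0) :=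
        Real.tendsto_exp_neg_atTop_nhds_zero.comp tendsto_natCast_atTop_atTop
      have hprod : Tendsto (fun m : ℕ => ((Real.exp (-(m : ℝ)), x) : ℝ × E)) atTop
          (𝓝 ((0 : ℝ), x)) := he.prodMk_nhds tendsto_const_nhds
      refine tendsto_nhdsWithin_iff.2 ⟨hprod, Eventually.of_forall fun m => ?_⟩
      exact Set.mk_mem_prod (Real.exp_pos _) (mem_univ _)
    have h := (UnboundedOperators.tendsto_heatExtension_nhdsWithin_prod hφ hC x).comp hq
    exact h
  have h := h1.sub h2
  rw [zero_sub] at h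
  exact h

end Representation

/-! ### The kernels along the sequence `ε = e^{-m}`, `R = e^m`, with uniform constants -/

/-- **Uniform Calderón–Zygmund data for the Riesz–heat kernels** (Stein 1970, Ch. II §3.2
Theorem 2, hypotheses, for the kernels `K_m = ∂ₐ∂ₐ(χ_{M_m} P_{e^{-m}, e^m})`): in dimension
`n ≥ 1` there is `B` such that for every `m` there is a truncation radius `M ≥ m + 1` for which,
for all `|a| ≤ 2`, the kernel is measurable and bounded, `‖K_m * h‖₂ ≤ 12‖h‖₂` on `C_c`, and
Hörmander's condition holds with constant `B`. [cite: Stein1971, Ch. II §3.2 Thm 2] -/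
theorem exists_uniform_kernel_data (hn : 1 ≤ Module.finrank ℝ E) :
    ∃ B : ℝ≥0, ∀ m : ℕ, ∃ M : ℝ, (m : ℝ) + 1 ≤ M ∧ ∀ a : E, ‖a‖ ≤ 2 →
      Measurable (rieszHeatKernel (E := E) (-(m : ℝ)) m M a) ∧
      (∃ M' : ℝ, ∀ z, |rieszHeatKernel (E := E) (-(m : ℝ)) m M a z| ≤ M') ∧
      (∀ h : E → ℝ, Continuous h → HasCompactSupport h →
        eLpNorm (fun x => ∫ t, h t * rieszHeatKernel (-(m : ℝ)) m M a (x - t)) 2 volume ≤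
          (12 : ℝ≥0) * eLpNorm h 2 volume) ∧
      (∀ y : E, ∫⁻ x in {x : E | 2 * ‖y‖ ≤ ‖x‖},
        ‖rieszHeatKernel (-(m : ℝ)) m M a (x - y) - rieszHeatKernel (-(m : ℝ)) m M a x‖ₑ ≤ B) := by
  haveI : Nontrivial E := Module.nontrivial_of_finrank_pos hn
  set n := Module.finrank ℝ E with hn_def
  obtain ⟨C_D, hC_D, hD⟩ := abs_heatKernelD2_le_parabolic (E := E)
  obtain ⟨C_T, hC_T, hT⟩ := norm_oseenIntegrand_le_parabolic (E := E)
  obtain ⟨C_χ, hC_χ, hχ⟩ := exists_norm_fderiv_cutoff_le (E := E)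
  obtain ⟨C_χ', hC_χ', hχ'⟩ := exists_norm_fderiv_fderiv_cutoff_le (E := E)
  set C_K : ℝ := 4 * (2 * C_T / (n + 1) + 4 * C_χ * C_D / n) with hC_K
  have hC_K0 : 0 ≤ C_K := by positivity
  set Btot : ℝ≥0∞ := ENNReal.ofReal (C_K * 2 ^ (n : ℝ) * (n * (volume : Measure E).real (ball 0 1))) + 2
    with hBtot
  have hBtop : Btot ≠ ⊤ := ENNReal.add_ne_top.2 ⟨ENNReal.ofReal_ne_top, ENNReal.ofNat_ne_top⟩
  refine ⟨Btot.toNNReal, fun m => ?_⟩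
  -- the two smallness thresholds for this `m`
  set α : ℝ := -(m : ℝ) with hα
  set β : ℝ := (m : ℝ) with hβ
  have hαβ : α ≤ β := by rw [hα, hβ]; linarith [(Nat.cast_nonneg m : (0 : ℝ) ≤ m)]
  have hL₀ := (lintegral_enorm_heatPot_lt_top (E := E) hαβ).ne
  have hL₁ := (lintegral_enorm_fderiv_heatPot_lt_top (E := E) hαβ).ne
  obtain ⟨M₁, hM₁1, hM₁⟩ := exists_forall_smallness hL₀ hL₁ (a := n * C_χ') (b := 2 * C_χ)
    (by positivity) (by positivity)
  obtain ⟨M₂, hM₂1, hM₂⟩ := exists_forall_smallness hL₀ hL₁ (a := 4 * C_χ') (b := 8 * C_χ)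
    (by positivity) (by positivity)
  set M : ℝ := max (max M₁ M₂) ((m : ℝ) + 1) with hM_def
  have hMm : (m : ℝ) + 1 ≤ M := le_max_right _ _
  have hM1 : M₁ ≤ M := (le_max_left _ _).trans (le_max_left _ _)
  have hM2 : M₂ ≤ M := (le_max_right _ _).trans (le_max_left _ _)
  have hM : 0 < M := by linarith [(Nat.cast_nonneg m : (0 : ℝ) ≤ m)]
  refine ⟨M, hMm, fun a ha => ⟨(continuous_rieszHeatKernel α β M a).measurable,
    exists_abs_rieszHeatKernel_le α β hM a, fun h hh hhc => ?_, fun y => ?_⟩⟩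
  · -- the `L²` bound: `‖ΔΦ‖₁ ≤ 3`
    refine eLpNorm_conv_rieszHeatKernel_le α β hM ?_ ha hh hhc
    calc ∫⁻ z, ‖(Δ (truncPot (E := E) α β M)) z‖ₑ
        ≤ 2 + ENNReal.ofReal (n * C_χ' / M ^ 2) * (∫⁻ z, ‖heatPot (E := E) α β z‖ₑ) +
            ENNReal.ofReal (2 * C_χ / M) * ∫⁻ z, ‖fderiv ℝ (heatPot (E := E) α β) z‖ₑ :=
          lintegral_enorm_laplacian_truncPot_le hC_χ hχ hC_χ' hχ' α β hM
      _ = 2 + (ENNReal.ofReal (n * C_χ' / M ^ 2) * (∫⁻ z, ‖heatPot (E := E) α β z‖ₑ) +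
            ENNReal.ofReal (2 * C_χ / M) * ∫⁻ z, ‖fderiv ℝ (heatPot (E := E) α β) z‖ₑ) := add_assoc _ _ _
      _ ≤ 2 + 1 := add_le_add le_rfl (hM₁ M hM1)
      _ = 3 := by norm_num
  · -- Hörmander: main part by the gradient bound, error part by `L¹`-smallness
    rw [ENNReal.coe_toNNReal hBtop, rieszHeatKernel_eq_add]
    have hk₁m : Measurable fun z => cutoff (E := E) M z * heatPotD2 α β a a z :=
      (differentiable_cutoff_mul_heatPotD2 α β M a).continuous.measurable
    have hk₂m : Measurable (rieszHeatKernelErr (E := E) α β M a) :=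
      (continuous_rieszHeatKernelErr α β M a).measurable
    refine (SingularIntegrals.lintegral_hormander_le_of_norm_fderiv_le_add volume hn hk₁m hk₂m hC_K0
      (fun z _ => (differentiable_cutoff_mul_heatPotD2 α β M a z))
      (fun z hz => norm_fderiv_cutoff_mul_heatPotD2_le hn hC_D hD hC_T hT hC_χ hχ hαβ hM ha hz) y).trans ?_
    refine add_le_add le_rfl ?_
    calc 2 * ∫⁻ z, ‖rieszHeatKernelErr (E := E) α β M a z‖ₑ
        ≤ 2 * (ENNReal.ofReal (4 * C_χ' / M ^ 2) * (∫⁻ z, ‖heatPot (E := E) α β z‖ₑ) +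
            ENNReal.ofReal (8 * C_χ / M) * ∫⁻ z, ‖fderiv ℝ (heatPot (E := E) α β) z‖ₑ) :=
          mul_le_mul' le_rfl (lintegral_enorm_rieszHeatKernelErr_le hC_χ hχ hC_χ' hχ' α β hM ha)
      _ ≤ 2 * 1 := mul_le_mul' le_rfl (hM₂ M hM2)
      _ = 2 := mul_one _

/-! ### Fatou along the sequence: the diagonal bound in every positive dimension -/

/-- **The diagonal bound `‖∂ₐ∂ₐf‖_p ≤ C_p ‖Δf‖_p`** for `f ∈ C²_c(E)`, `|a| ≤ 2`, `1 < p < ∞`,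
`dim E ≥ 1` (the uniform Calderón–Zygmund theorem `SingularIntegrals.exists_eLpNorm_le` for the
Riesz–heat kernels, the representation of `K_m * Δf`, and Fatou along `m → ∞`).
[cite: Stein1971, Ch. III §1.3 Prop 3] -/
theorem exists_eLpNorm_fderiv_fderiv_le_general (hn : 1 ≤ Module.finrank ℝ E) {p : ℝ≥0∞}
    (hp : 1 < p) (hp' : p < ⊤) :
    ∃ C : ℝ≥0, ∀ f : E → ℝ, ContDiff ℝ 2 f → HasCompactSupport f → ∀ a : E, ‖a‖ ≤ 2 →
      eLpNorm (fun x => fderiv ℝ (fun s => fderiv ℝ f s a) x a) p volume ≤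
        C * eLpNorm (Δ f) p volume := by
  haveI : Nontrivial E := Module.nontrivial_of_finrank_pos hn
  obtain ⟨B, hB⟩ := exists_uniform_kernel_data (E := E) hn
  obtain ⟨C, hC⟩ := SingularIntegrals.exists_eLpNorm_le.{u} (Module.finrank ℝ E) 12 B hp hp'
  refine ⟨C, fun f hf hfc a ha => ?_⟩
  choose M hM using hB
  -- the data of `f`
  have hΔc : Continuous (Δ f) := continuous_laplacian hf
  have hΔcs : HasCompactSupport (Δ f) :=
    HasCompactSupport.intro hfc fun x hx => laplacian_eq_zero_of_notMem_tsupport hx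
  have hΔb : ∃ C' : ℝ, ∀ x, |(Δ f) x| ≤ C' := by
    obtain ⟨C', hC'⟩ := hΔc.bounded_above_of_compact_support hΔcs
    exact ⟨C', fun x => by rw [← Real.norm_eq_abs]; exact hC' x⟩
  obtain ⟨ρ, hρ⟩ := hfc.isCompact.isBounded.subset_closedBall 0
  set φ : E → ℝ := fun x => fderiv ℝ (fun s => fderiv ℝ f s a) x a with hφ
  have hφc : Continuous φ := continuous_fderiv_fderiv_apply hf a a
  have hφcs : HasCompactSupport φ := hasCompactSupport_fderiv_fderiv_apply hfc a a
  -- the regularised sequence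
  set u : ℕ → E → ℝ := fun m x => ∫ t, (Δ f) t * rieszHeatKernel (-(m : ℝ)) m (M m) a (x - t)
    with hu
  have hmeas : ∀ m, AEStronglyMeasurable (u m) volume := fun m =>
    aestronglyMeasurable_integral_mul_comp_sub hΔc (continuous_rieszHeatKernel _ _ _ a)
  have hbound : ∀ m, eLpNorm (u m) p volume ≤ C * eLpNorm (Δ f) p volume := by
    intro m
    obtain ⟨hkm, hkb, hL2, hHor⟩ := (hM m).2 a ha
    exact hC (E := E) volume rfl hkm hkb hL2 hHor (Δ f) hΔc.measurable hΔb hΔcs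
  have hlim : ∀ x, Tendsto (fun m => u m x) atTop (𝓝 (-φ x)) := by
    intro x
    have hev : ∀ᶠ m : ℕ in atTop, u m x =
        heatExtension φ (Real.exp m) x - heatExtension φ (Real.exp (-(m : ℝ))) x := by
      obtain ⟨m₀, hm₀⟩ := exists_nat_gt (‖x‖ + ρ)
      filter_upwards [eventually_ge_atTop m₀] with m hm
      have hMpos : 0 < M m := by linarith [(hM m).1, (Nat.cast_nonneg m : (0 : ℝ) ≤ m)]
      have hxM : ‖x‖ + ρ < M m := by
        have : (m₀ : ℝ) ≤ m := by exact_mod_cast hm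
        linarith [(hM m).1]
      exact integral_laplacian_mul_rieszHeatKernel (-(m : ℝ)) m hMpos hf hfc hρ hxM a
    exact (tendsto_heatExtension_exp_sub hn hφc hφcs x).congr' (EventuallyEq.symm hev)
  have hfatou := Lp.eLpNorm_lim_le_liminf_eLpNorm (p := p) hmeas (-φ) (Eventually.of_forall hlim)
  rw [eLpNorm_neg] at hfatou
  exact hfatou.trans (Filter.liminf_le_of_frequently_le' (Eventually.of_forall hbound).frequently)

end RieszHeat

/-! ### The discharge in every dimension -/

/-- **Discharge of `stein1970_hessian_Lp_bound E` for every finite-dimensional real inner product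
space `E`** (Stein 1970, Ch. III §1.3, Proposition 3, p. 59): for every `1 < p < ∞` there is
`A = A_p` such that for every `f ∈ C²(E)` with compact support and all `|a|, |b| ≤ 1`,
`‖∂_b∂ₐ f‖_{L^p} ≤ A ‖Δf‖_{L^p}`. PROVED: in positive dimension the diagonal case is
`RieszHeat.exists_eLpNorm_fderiv_fderiv_le_general` (Calderón–Zygmund theory of the tree applied to
the Riesz kernels of the heat semigroup), the mixed case follows by polarisation
`∂_b∂ₐf = ¼(∂²_{a+b}f − ∂²_{a−b}f)` (Schwarz) with `A = 2C_p`; in dimension `0` both sides vanish.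
[cite: Stein1971, Ch. III §1.3 Prop 3] -/
theorem stein1970_hessian_Lp_bound_holds : stein1970_hessian_Lp_bound E := by
  intro p hp hp'
  rcases Nat.eq_zero_or_pos (Module.finrank ℝ E) with h0 | hpos
  · -- dimension `0`: `E` is trivial and second derivatives vanish
    haveI : Subsingleton E := Module.finrank_zero_iff.1 h0
    refine ⟨0, fun f hf hfc a b ha hb => ?_⟩
    have : (fun x => fderiv ℝ (fun y => fderiv ℝ f y a) x b) = fun _ => 0 := by
      funext x
      rw [Subsingleton.elim b 0, map_zero]
    rw [this]
    simp
  obtain ⟨C, hC⟩ := RieszHeat.exists_eLpNorm_fderiv_fderiv_le_general (E := E) hpos hp hp'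
  refine ⟨2 * C, fun f hf hfc a b ha hb => ?_⟩
  -- polarisation
  set g₁ : E → ℝ := fun x => fderiv ℝ (fun y => fderiv ℝ f y (a + b)) x (a + b) with hg₁
  set g₂ : E → ℝ := fun x => fderiv ℝ (fun y => fderiv ℝ f y (a - b)) x (a - b) with hg₂
  have hpol : (fun x => fderiv ℝ (fun y => fderiv ℝ f y a) x b) = (1 / 4 : ℝ) • (g₁ - g₂) := by
    funext x
    have hD : Differentiable ℝ (fderiv ℝ f) :=
      (hf.fderiv_right (m := 1) le_rfl).differentiable one_ne_zero
    have key : ∀ u v, fderiv ℝ (fun y => fderiv ℝ f y u) x v = fderiv ℝ (fderiv ℝ f) x v u :=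
      fun u v => fderiv_apply_const_apply (hD x) u v
    have hsymm : fderiv ℝ (fderiv ℝ f) x a b = fderiv ℝ (fderiv ℝ f) x b a :=
      (hf.contDiffAt.isSymmSndFDerivAt (n := 2) (by simp)) a b
    have e0 : fderiv ℝ (fun y => fderiv ℝ f y a) x b = fderiv ℝ (fderiv ℝ f) x b a := key a b
    have e1 : g₁ x = fderiv ℝ (fderiv ℝ f) x (a + b) (a + b) := key (a + b) (a + b)
    have e2 : g₂ x = fderiv ℝ (fderiv ℝ f) x (a - b) (a - b) := key (a - b) (a - b)
    rw [Pi.smul_apply, Pi.sub_apply, e0, e1, e2, smul_eq_mul]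
    simp only [map_add, map_sub, _root_.add_apply, _root_.sub_apply]
    linarith [hsymm]
  have hab : ‖a + b‖ ≤ 2 := (norm_add_le _ _).trans (by linarith)
  have hab' : ‖a - b‖ ≤ 2 := (norm_sub_le _ _).trans (by linarith)
  have h1 : eLpNorm g₁ p volume ≤ C * eLpNorm (Δ f) p volume := hC f hf hfc (a + b) hab
  have h2 : eLpNorm g₂ p volume ≤ C * eLpNorm (Δ f) p volume := hC f hf hfc (a - b) hab'
  have hm1 : AEStronglyMeasurable g₁ volume :=
    (continuous_fderiv_fderiv_apply hf (a + b) (a + b)).aestronglyMeasurable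
  have hm2 : AEStronglyMeasurable g₂ volume :=
    (continuous_fderiv_fderiv_apply hf (a - b) (a - b)).aestronglyMeasurable
  have hquarter : ‖(1 / 4 : ℝ)‖ₑ ≤ 1 := by
    rw [Real.enorm_eq_ofReal (by norm_num)]
    exact ENNReal.ofReal_le_one.2 (by norm_num)
  rw [hpol]
  calc eLpNorm ((1 / 4 : ℝ) • (g₁ - g₂)) p volume
      ≤ ‖(1 / 4 : ℝ)‖ₑ * eLpNorm (g₁ - g₂) p volume := eLpNorm_const_smul_le
    _ ≤ ‖(1 / 4 : ℝ)‖ₑ * (eLpNorm g₁ p volume + eLpNorm g₂ p volume) := by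
        gcongr
        exact eLpNorm_sub_le hm1 hm2 hp.le
    _ ≤ 1 * (C * eLpNorm (Δ f) p volume + C * eLpNorm (Δ f) p volume) := by gcongr
    _ = ↑(2 * C) * eLpNorm (Δ f) p volume := by
        push_cast
        ring

end Literature.Analysis.FluidPDE
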